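import Mathlib
import HarnessLib
import Summits.HubbardSuperconductivity.HubbardSuperconductivity.Theorems.KLProgrammeKLRegimeVolumeLimitCauchy

/-!
# Route `KLProgramme` — VL child `KLRegimeVolumeLimitV12` (stmt-HubbardSuperconductivity-19858) / its gen-5 re-base, Cauchy stub
# `stub_vl_twoVolumeRate`: a LABEL-UNIFORM CAUCHY condition in the Matsubara cutoff yields the cutoff-free proxies of the three-input door
# (cell gate-hubbard-kl, seat hubbard-kl-k3c4-p1 g4; interface lemma between the all-`U` lane's natural output and hypothesis (hcut) of
# `twoVolumeRate_of_matsubaraLimit` / `stub_vl_twoVolumeRate_of_bareSplit`)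

The three-input door (`…VolumeLimitDoorsV14.stub_vl_twoVolumeRate_of_bareSplit`) asks, in the cutoff direction, for proxies
`S∞_L : ℤ → TorusSite 2 L → Fin 2 → ℂ` with `‖S_{L,M}((ω,k),σ) − S∞_L(n_ω,k,σ)‖ ≤ ε` for `M ≥ M₁(L,ε)`, UNIFORMLY in the kept label.  The
all-`U` lane's statements come as label-uniform CAUCHY estimates in `M` at fixed volume (two cutoffs, equal Matsubara integers; e.g. the
`L¹(du)`-distance of the word functions bounds `sup_k ‖βL²(b_M − b_{M′})(k)‖`).  `exists_cutoffProxy_of_labelUniformCauchy` converts one into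
the other: the proxy is the limit along the cutoff of the value at the label carrying the given integer (which exists once `−M ≤ n < M`,
and is unique), and the uniform Cauchy modulus passes to the limit.  Pure bookkeeping
(completeness of `ℂ`); nothing is asserted about the model.
-/

noncomputable section

namespace Summit.HubbardSuperconductivity.HubbardSuperconductivity.Theorems.KLRegimeSplit

set_option linter.dupNamespace false -- summit = problem name (single-conjunct summit), D-0017

open Filter Topology Finset Literature.MathematicalPhysics.QuantumLattice Literature.Probability.LatticeModels
open Summit.HubbardSuperconductivity.HubbardSuperconductivity.Theorems.KLProgrammeLegKernels

/-- **Label-uniform Cauchy in the cutoff ⇒ cutoff-free proxies with label-uniform convergence.**  See the module docstring. [folklore] -/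
theorem exists_cutoffProxy_of_labelUniformCauchy
    {S : ∀ (L M : ℕ) [NeZero L] [NeZero M], FreqMomentum L M → Fin 2 → ℂ} {L₀ : ℕ}
    (hC : ∀ (L : ℕ) [NeZero L], L₀ ≤ L → ∀ ε : ℝ, 0 < ε → ∃ M₁ : ℕ, ∀ (M : ℕ) [NeZero M], M₁ ≤ M → ∀ (M' : ℕ) [NeZero M'], M₁ ≤ M' →
      ∀ (ω : MatsubaraIdx M) (ω' : MatsubaraIdx M'), matsubaraInt M ω = matsubaraInt M' ω' →
        ∀ (k : TorusSite 2 L) (σ : Fin 2), ‖S L M (ω, k) σ - S L M' (ω', k) σ‖ ≤ ε) :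
    ∃ Sinf : ∀ (L : ℕ) [NeZero L], ℤ → TorusSite 2 L → Fin 2 → ℂ,
      ∀ (L : ℕ) [NeZero L], L₀ ≤ L → ∀ ε : ℝ, 0 < ε → ∃ M₁ : ℕ, ∀ (M : ℕ) [NeZero M], M₁ ≤ M →
        ∀ (ω : MatsubaraIdx M) (k : TorusSite 2 L) (σ : Fin 2), ‖S L M (ω, k) σ - Sinf L (matsubaraInt M ω) k σ‖ ≤ ε := by
  classical
  -- labels: the integer `n` is carried by a (unique) label at cutoff `M` iff `-M ≤ n < M`
  have hexists : ∀ {M : ℕ} {n : ℤ}, -(M : ℤ) ≤ n ∧ n < M → ∃ ω : MatsubaraIdx M, matsubaraInt M ω = n := by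
    intro M n h
    refine ⟨⟨(n + M).toNat, by omega⟩, ?_⟩
    show (((n + (M : ℤ)).toNat : ℕ) : ℤ) - (M : ℤ) = n
    omega
  have hinj : ∀ {M : ℕ} (i j : MatsubaraIdx M), matsubaraInt M i = matsubaraInt M j → i = j := by
    intro M i j h
    simp only [matsubaraInt] at h
    exact Fin.ext (by exact_mod_cast (sub_left_inj.1 h))
  have hrange : ∀ {M : ℕ} (ω : MatsubaraIdx M), -(M : ℤ) ≤ matsubaraInt M ω ∧ matsubaraInt M ω < M := by
    intro M ω
    have h1 := ω.isLt
    simp only [matsubaraInt]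
    omega
  -- the value at the label carrying the integer `n`, at cutoff `M` (zero when the label does not exist)
  set u : ∀ (L : ℕ) [NeZero L], ℤ → TorusSite 2 L → Fin 2 → ℕ → ℂ := fun L _ n k σ M =>
    if h : -(M : ℤ) ≤ n ∧ n < M then
      (by haveI : NeZero M := ⟨by omega⟩; exact S L M (Classical.choose (hexists h), k) σ)
    else 0 with hu
  -- `u` at a cutoff where the label exists IS the value at any label with that integer
  have hu_eq : ∀ (L : ℕ) [NeZero L] (M : ℕ) [NeZero M] (ω : MatsubaraIdx M) (k : TorusSite 2 L) (σ : Fin 2),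
      u L (matsubaraInt M ω) k σ M = S L M (ω, k) σ := by
    intro L _ M _ ω k σ
    have h := hrange ω
    have hsel : Classical.choose (hexists h) = ω := hinj _ _ (Classical.choose_spec (hexists h))
    simp only [hu, dif_pos h, hsel]
  -- the selected sequence is Cauchy beyond `L₀`
  have hcauchy : ∀ (L : ℕ) [NeZero L], L₀ ≤ L → ∀ (n : ℤ) (k : TorusSite 2 L) (σ : Fin 2), CauchySeq (u L n k σ) := by
    intro L _ hL n k σ
    refine Metric.cauchySeq_iff.2 fun ε hε => ?_
    obtain ⟨M₁, hM₁⟩ := hC L hL (ε / 2) (half_pos hε)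
    refine ⟨max M₁ (n.natAbs + 1), fun M hM M' hM' => ?_⟩
    have hnM : -(M : ℤ) ≤ n ∧ n < M := by have := le_of_max_le_right hM; omega
    have hnM' : -(M' : ℤ) ≤ n ∧ n < M' := by have := le_of_max_le_right hM'; omega
    haveI : NeZero M := ⟨by omega⟩
    haveI : NeZero M' := ⟨by omega⟩
    have hω := Classical.choose_spec (hexists hnM)
    have hω' := Classical.choose_spec (hexists hnM')
    have h := hM₁ M (le_of_max_le_left hM) M' (le_of_max_le_left hM') (Classical.choose (hexists hnM))
      (Classical.choose (hexists hnM')) (hω.trans hω'.symm) k σ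
    rw [dist_eq_norm]
    simp only [hu, dif_pos hnM, dif_pos hnM']
    linarith
  -- the proxies: limits along the cutoff
  refine ⟨fun L _ n k σ => limUnder atTop (u L n k σ), fun L _ hL ε hε => ?_⟩
  obtain ⟨M₁, hM₁⟩ := hC L hL ε hε
  refine ⟨M₁, fun M _ hM ω k σ => ?_⟩
  set n : ℤ := matsubaraInt M ω with hn
  have hlim : Tendsto (u L n k σ) atTop (𝓝 (limUnder atTop (u L n k σ))) := (hcauchy L hL n k σ).tendsto_limUnder
  -- the uniform Cauchy bound against every later cutoff, then the limit
  have hev : ∀ᶠ M' : ℕ in atTop, ‖S L M (ω, k) σ - u L n k σ M'‖ ≤ ε := by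
    refine Filter.eventually_atTop.2 ⟨max M₁ (n.natAbs + 1), fun M' hM' => ?_⟩
    have hnM' : -(M' : ℤ) ≤ n ∧ n < M' := by have := le_of_max_le_right hM'; omega
    haveI : NeZero M' := ⟨by omega⟩
    have hω' := Classical.choose_spec (hexists hnM')
    have h := hM₁ M hM M' (le_of_max_le_left hM') ω (Classical.choose (hexists hnM')) (by rw [hω']) k σ
    simp only [hu, dif_pos hnM']
    exact h
  have hcont : Tendsto (fun M' : ℕ => ‖S L M (ω, k) σ - u L n k σ M'‖) atTop
      (𝓝 ‖S L M (ω, k) σ - limUnder atTop (u L n k σ)‖) := (tendsto_const_nhds.sub hlim).norm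
  exact le_of_tendsto hcont hev

end Summit.HubbardSuperconductivity.HubbardSuperconductivity.Theorems.KLRegimeSplit

end
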